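import Literature.IUT.HodgeTheaters.TemperedCoveringsOfSpecialFibreFiniteGraph
import Literature.IUT.HodgeTheaters.StableCurveTemperedDataOfSpecialFibreWholeGraph
import HarnessLib

/-!
# [IUTchI] Prop. 2.2 AS TYPED at the genuine 𝔛-datum in the instance `ℍ := 𝔾`, FINITE special fibre:
# residual = a verticial family and node data with (A3) only

Mochizuki, *Inter-universal Teichmüller theory I*, kurims manuscript (May 2020), §2, Prop. 2.2
"Commensurators of Decomposition Subgroups Associated to Sub-semi-graphs" pp. 45–46, for "`ℍ ⊆ 𝔾` a
[connected] sub-semi-graph" (p. 44 l. 36) taken to be ALL of `𝔾` [cite: Mochizuki2012, Prop 2.2 pp.45-46]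
(D-0012 claim key; series status DISPUTED; nothing of the series is asserted here), over [SemiAnbd]
Thm. 3.7 (i)/(iii) pp. 40–41, Ex. 3.10 pp. 43–45 [cite: MochizukiSemiAnbd2006, Thm 3.7 pp.40-41; Ex 3.10 pp.43-45].

PROOF-ONLY companion (abc-iut cell, F fact-proving wave, seat abc-iut-f-192, tranche 192, FROZEN FACT-LIST row
**F-2590** `TemperedGraphGroupData.CommensuratorsOfDecompositionSubgroups`; no definition, no new `Prop` fact) of
this seat's `TemperedCoveringsOfSpecialFibreFiniteGraph.lean` (p433285) and abc-iut-w4-d055's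
`StableCurveTemperedDataOfSpecialFibreWholeGraph.lean` (p433082), composed BY NAME as w4-d055 proposed
(STATUS 08:53:34Z): in the instance `ℍ := 𝔾` — bridge parameters `TpH := ⊤`, `HatH := ⊤`,
`hle := wholeGraph_hle X d S h36` — Prop. 2.2 AS TYPED (all four clauses, the certificate binder `h22`) is
EQUIVALENT to its single clause `tp_in_hat` "`Π^tp_𝔾` is commensurably terminal in `Π̂_𝔾`"
(`wholeGraph_prop22_iff`), and that clause is `graph_tp_isCommensurablyTerminal_ofSpecialFibre_of_finiteGraph`
at a FINITE special-fibre semi-graph with every [SemiAnbd] §3 input a kernel theorem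
(`compactInVerticialAt_of_finiteGraph`, `verticialInjective_holds`, `galoisDomination_of_prop36`).  NET:
* `graph_conj_le_ofSpecialFibre_of_finiteGraph` — (A1) at the datum (any bridge parameters): every compact
  `Λ ⊆ Π^tp_𝔾` lies in a conjugate of the chosen verticial subgroup at some vertex; binders: the family only;
* `graph_prop22_wholeGraph_ofSpecialFibre_of_finiteGraph` — **F-2590 INSTANCE AS TYPED at `ℍ := 𝔾`**,
  `(ofSpecialFibre X d S h36 Σ Σ̂ hsub hne hprime hp ⊤ ⊤ (wholeGraph_hle X d S h36) cuspMeetsH).graph.CommensuratorsOfDecompositionSubgroups`,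
  modulo ONLY a verticial family `Λv`/`hΛv` and node data `src tgt c₁ c₂` with (A3) — NO `ℍ`-side chart data,
  NO `hHatH`, NO [SemiAnbd] §3 binder;
* `graph_prop22_wholeGraph_byName_ofSpecialFibre_of_finiteGraph` — the same with (A3) := the FROZEN FACT-LIST
  row F-2540 `PSCDatum.VerticialIntersectionNear` ([NodNon] Lem. 1.9 (ii)) BY NAME over a `PSCDatum` on `Π̂_𝔾`.
Typed ≠ proved at infinite graphs or proper `ℍ`; a FACT row is an assumption label; no side taken on
[IUTchIII] Cor. 3.12.
-/

noncomputable section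

namespace Literature.IUT.HodgeTheaters

open Pointwise
open _root_.Topology
open Literature.AnabelianGeometry.SemiGraphs (IsProfiniteCompletion PSCDatum ProfiniteSemiGraph SpecialFibreData
  TemperedCurve)
open Literature.AnabelianGeometry.SemiGraphs.ProfiniteSemiGraph (TemperedPiChart verticialSubgroups
  compactInVerticialAt_of_finiteGraph)
open Literature.AnabelianGeometry.AbsoluteAnabelian (IsCommensurablyTerminal)

namespace StableCurveTemperedData

variable {p : ℕ} [Fact p.Prime] (X : TemperedCurve p) (d : X.GroupLevelData)
  (S : SpecialFibreData (X.toTemperedArithmeticGroup d)) (h36 : S.Gc.Prop36Hypotheses)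
  (Sigma SigmaHat : Set ℕ) (hsub : Sigma ⊆ SigmaHat) (hne : Sigma.Nonempty)
  (hprime : ∀ q ∈ SigmaHat, q.Prime) (hp : p ∉ Sigma)
  (cuspMeetsH : {x : X.Pt // X.IsCusp x} → Prop)

/-! ### (A1) at the datum, any parameters: compact subgroups lie in conjugates of the verticial family -/

/-- **(A1) at the genuine 𝔛-datum, no Thm. 3.7 hypothesis** ([IUTchI] p. 45 "it follows from [SemiAnbd]
Thm 3.7 (iii) that `Λ`, `γ·Λ·γ⁻¹` are contained in verticial subgroups"): for a FINITE special fibre, every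
compact `Λ ⊆ Π^tp_𝔾 = π₁^temp(G^c)` lies in a `Π^tp_𝔾`-conjugate of the chosen verticial subgroup at some
vertex — Thm. 3.7 (iii) being `compactInVerticialAt_of_finiteGraph`, Thm. 3.7 (i) ("the verticial subgroups
at `v` form one conjugacy class") inside `conj_le_of_compactInVerticial_at`.  Any bridge parameters
`TpH HatH hle`. [cite: Mochizuki2012, Prop 2.1 p.45] -/
theorem graph_conj_le_ofSpecialFibre_of_finiteGraph [Finite S.Gc.graph.Vertex] [Finite S.Gc.graph.Edge]
    (TpH : Subgroup S.chart.G)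
    (HatH : Subgroup (TemperedGraphGroupData.exists_completion_of_prop36 S.Gc h36 S.chart).choose)
    (hle : TpH.map (TemperedGraphGroupData.exists_completion_of_prop36 S.Gc h36
      S.chart).choose_spec.choose.toMonoidHom ≤ HatH)
    (Λv : S.Gc.graph.Vertex →
      Subgroup (ofSpecialFibre X d S h36 Sigma SigmaHat hsub hne hprime hp TpH HatH hle cuspMeetsH).graph.Tp)
    (hΛv : ∀ v, Λv v ∈ verticialSubgroups S.chart v)
    (Λ : Subgroup (ofSpecialFibre X d S h36 Sigma SigmaHat hsub hne hprime hp TpH HatH hle cuspMeetsH).graph.Tp)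
    (hΛc : IsCompact (Λ : Set (ofSpecialFibre X d S h36 Sigma SigmaHat hsub hne hprime hp TpH HatH hle
      cuspMeetsH).graph.Tp)) :
    ∃ (v : S.Gc.graph.Vertex)
      (t : (ofSpecialFibre X d S h36 Sigma SigmaHat hsub hne hprime hp TpH HatH hle cuspMeetsH).graph.Tp),
      Λ ≤ MulAut.conj t • Λv v :=
  (ofSpecialFibre X d S h36 Sigma SigmaHat hsub hne hprime hp TpH HatH hle
      cuspMeetsH).graph.conj_le_of_compactInVerticial_at S.chart
    (@id ((ofSpecialFibre X d S h36 Sigma SigmaHat hsub hne hprime hp TpH HatH hle cuspMeetsH).graph.Tp ≃ₜ*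
      S.chart.G) (ContinuousMulEquiv.refl _)) S.hyp compactInVerticialAt_of_finiteGraph Λv
    (fun v => by
      rw [ofSpecialFibre_graph_map_refl X d S h36 Sigma SigmaHat hsub hne hprime hp TpH HatH hle cuspMeetsH]
      exact hΛv v) Λ hΛc

/-! ### Node data with (A3) -/

section NodeData

variable (Λv : S.Gc.graph.Vertex →
    Subgroup (ofSpecialFibre X d S h36 Sigma SigmaHat hsub hne hprime hp ⊤ ⊤ (wholeGraph_hle X d S h36)
      cuspMeetsH).graph.Tp)
  (hΛv : ∀ v, Λv v ∈ verticialSubgroups S.chart v)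
  {E : Type*} (src tgt : E → S.Gc.graph.Vertex)
  (c₁ c₂ : E → (ofSpecialFibre X d S h36 Sigma SigmaHat hsub hne hprime hp ⊤ ⊤ (wholeGraph_hle X d S h36)
      cuspMeetsH).graph.Tp)
  (hA3 : ∀ (v w : S.Gc.graph.Vertex)
      (g h : (ofSpecialFibre X d S h36 Sigma SigmaHat hsub hne hprime hp ⊤ ⊤ (wholeGraph_hle X d S h36)
        cuspMeetsH).graph.Hat),
      MulAut.conj g •
            (Λv v).map (ofSpecialFibre X d S h36 Sigma SigmaHat hsub hne hprime hp ⊤ ⊤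
              (wholeGraph_hle X d S h36) cuspMeetsH).graph.ι ⊓
          MulAut.conj h •
            (Λv w).map (ofSpecialFibre X d S h36 Sigma SigmaHat hsub hne hprime hp ⊤ ⊤
              (wholeGraph_hle X d S h36) cuspMeetsH).graph.ι ≠ ⊥ →
        (v = w ∧ g⁻¹ * h ∈ (Λv v).map (ofSpecialFibre X d S h36 Sigma SigmaHat hsub hne hprime hp ⊤ ⊤
          (wholeGraph_hle X d S h36) cuspMeetsH).graph.ι) ∨
        ∃ (e : E) (k : (ofSpecialFibre X d S h36 Sigma SigmaHat hsub hne hprime hp ⊤ ⊤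
            (wholeGraph_hle X d S h36) cuspMeetsH).graph.Hat),
          ∃ r ∈ (Λv (src e)).map (ofSpecialFibre X d S h36 Sigma SigmaHat hsub hne hprime hp ⊤ ⊤
              (wholeGraph_hle X d S h36) cuspMeetsH).graph.ι,
          ∃ q ∈ (Λv (tgt e)).map (ofSpecialFibre X d S h36 Sigma SigmaHat hsub hne hprime hp ⊤ ⊤
              (wholeGraph_hle X d S h36) cuspMeetsH).graph.ι,
            (src e = v ∧ tgt e = w ∧
                g = k * (ofSpecialFibre X d S h36 Sigma SigmaHat hsub hne hprime hp ⊤ ⊤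
                  (wholeGraph_hle X d S h36) cuspMeetsH).graph.ι (c₁ e) * r ∧
                h = k * (ofSpecialFibre X d S h36 Sigma SigmaHat hsub hne hprime hp ⊤ ⊤
                  (wholeGraph_hle X d S h36) cuspMeetsH).graph.ι (c₂ e) * q) ∨
            (src e = w ∧ tgt e = v ∧
                h = k * (ofSpecialFibre X d S h36 Sigma SigmaHat hsub hne hprime hp ⊤ ⊤
                  (wholeGraph_hle X d S h36) cuspMeetsH).graph.ι (c₁ e) * r ∧
                g = k * (ofSpecialFibre X d S h36 Sigma SigmaHat hsub hne hprime hp ⊤ ⊤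
                  (wholeGraph_hle X d S h36) cuspMeetsH).graph.ι (c₂ e) * q))

include hΛv hA3 in
/-- **F-2590 INSTANCE AS TYPED in the instance `ℍ := 𝔾` — [IUTchI] Prop. 2.2, all four commensurator
clauses, at the genuine 𝔛-datum with `TpH := ⊤`, `HatH := ⊤` and FINITE special fibre**: by
abc-iut-w4-d055's `wholeGraph_prop22_iff` the four clauses reduce to `tp_in_hat`, which is
`graph_tp_isCommensurablyTerminal_ofSpecialFibre_of_finiteGraph` ([SemiAnbd] Thm. 3.7 (i)/(iii) and Galois
domination being kernel theorems); residual = a verticial family and node data with (A3) only.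
([IUTchI] Prop 2.2 pp.45-46) [cite: Mochizuki2012, Prop 2.2 pp.45-46] [claim: Mochizuki2012, status: disputed] -/
theorem graph_prop22_wholeGraph_ofSpecialFibre_of_finiteGraph [Finite S.Gc.graph.Vertex]
    [Finite S.Gc.graph.Edge] :
    (ofSpecialFibre X d S h36 Sigma SigmaHat hsub hne hprime hp ⊤ ⊤ (wholeGraph_hle X d S h36)
      cuspMeetsH).graph.CommensuratorsOfDecompositionSubgroups :=
  (wholeGraph_prop22_iff X d S h36 Sigma SigmaHat hsub hne hprime hp cuspMeetsH).2
    (graph_tp_isCommensurablyTerminal_ofSpecialFibre_of_finiteGraph X d S h36 Sigma SigmaHat hsub hne hprime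
      hp ⊤ ⊤ (wholeGraph_hle X d S h36) cuspMeetsH Λv hΛv src tgt c₁ c₂ hA3)

end NodeData

/-! ### BY NAME over a `PSCDatum` on `Π̂_𝔾` — (A3) is F-2540 `VerticialIntersectionNear` -/

section ByName

variable
  (G : PSCDatum (ofSpecialFibre X d S h36 Sigma SigmaHat hsub hne hprime hp ⊤ ⊤ (wholeGraph_hle X d S h36)
    cuspMeetsH).graph.Hat)
  (hNN : G.VerticialIntersectionNear) (σ : S.Gc.graph.Vertex ≃ G.graph.V)
  (Λv : G.graph.V →
    Subgroup (ofSpecialFibre X d S h36 Sigma SigmaHat hsub hne hprime hp ⊤ ⊤ (wholeGraph_hle X d S h36)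
      cuspMeetsH).graph.Tp)
  (hvert : ∀ v : S.Gc.graph.Vertex, Λv (σ v) ∈ verticialSubgroups S.chart v)
  (hΛv : ∀ v, (Λv v).map (ofSpecialFibre X d S h36 Sigma SigmaHat hsub hne hprime hp ⊤ ⊤
    (wholeGraph_hle X d S h36) cuspMeetsH).graph.ι = G.vertGp v)
  (src tgt : G.graph.N → G.graph.V)
  (c₁ c₂ : G.graph.N →
    (ofSpecialFibre X d S h36 Sigma SigmaHat hsub hne hprime hp ⊤ ⊤ (wholeGraph_hle X d S h36)
      cuspMeetsH).graph.Tp)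
  (hends : ∀ e, G.graph.nodeEnds e = s(src e, tgt e))
  (h₁ : ∀ e, G.nodeGp e ≤
    MulAut.conj ((ofSpecialFibre X d S h36 Sigma SigmaHat hsub hne hprime hp ⊤ ⊤ (wholeGraph_hle X d S h36)
      cuspMeetsH).graph.ι (c₁ e)) • G.vertGp (src e))
  (h₂ : ∀ e, G.nodeGp e ≤
    MulAut.conj ((ofSpecialFibre X d S h36 Sigma SigmaHat hsub hne hprime hp ⊤ ⊤ (wholeGraph_hle X d S h36)
      cuspMeetsH).graph.ι (c₂ e)) • G.vertGp (tgt e))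
  (hloop : ∀ e, src e = tgt e → (c₁ e)⁻¹ * c₂ e ∉ Λv (src e))

include hNN hvert hΛv hends h₁ h₂ hloop in
/-- **F-2590 INSTANCE AS TYPED in the instance `ℍ := 𝔾`, every printed input BY NAME** — [IUTchI]
Prop. 2.2 (all four clauses) at the genuine 𝔛-datum with `TpH := ⊤`, `HatH := ⊤`, FINITE special fibre,
(A3) := the FROZEN FACT-LIST row F-2540 `PSCDatum.VerticialIntersectionNear` ([NodNon] Lem. 1.9 (ii)) BY NAME
over a `PSCDatum` on `Π̂_𝔾` matched with a verticial family of the chart; via `wholeGraph_prop22_iff` and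
`graph_prop22_inParticular_byName_ofSpecialFibre_of_finiteGraph`.
([IUTchI] Prop 2.2 pp.45-46) [cite: Mochizuki2012, Prop 2.2 pp.45-46] [claim: Mochizuki2012, status: disputed] -/
theorem graph_prop22_wholeGraph_byName_ofSpecialFibre_of_finiteGraph [Finite S.Gc.graph.Vertex]
    [Finite S.Gc.graph.Edge] :
    (ofSpecialFibre X d S h36 Sigma SigmaHat hsub hne hprime hp ⊤ ⊤ (wholeGraph_hle X d S h36)
      cuspMeetsH).graph.CommensuratorsOfDecompositionSubgroups :=
  (wholeGraph_prop22_iff X d S h36 Sigma SigmaHat hsub hne hprime hp cuspMeetsH).2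
    (graph_prop22_inParticular_byName_ofSpecialFibre_of_finiteGraph X d S h36 Sigma SigmaHat hsub hne
      hprime hp ⊤ ⊤ (wholeGraph_hle X d S h36) cuspMeetsH G hNN σ Λv hvert hΛv src tgt c₁ c₂ hends h₁ h₂
      hloop)

include hNN hvert hΛv hends h₁ h₂ hloop in
/-- **Rmk. 2.2.2 in the instance `ℍ := 𝔾` from Prop. 2.2** (bookkeeping: abc-iut-L5-t1's
`temperedNormallyTerminal_of_prop22` applied to `graph_prop22_wholeGraph_byName_ofSpecialFibre_of_finiteGraph`;
the direct route is `graph_temperedNormallyTerminal_byName_ofSpecialFibre_of_finiteGraph`).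
([IUTchI] Rmk 2.2.2 p.46) [cite: Mochizuki2012, Rmk 2.2.2 p.46] [claim: Mochizuki2012, status: disputed] -/
theorem graph_temperedNormallyTerminal_wholeGraph_byName_ofSpecialFibre_of_finiteGraph
    [Finite S.Gc.graph.Vertex] [Finite S.Gc.graph.Edge] :
    (ofSpecialFibre X d S h36 Sigma SigmaHat hsub hne hprime hp ⊤ ⊤ (wholeGraph_hle X d S h36)
      cuspMeetsH).graph.TemperedNormallyTerminal :=
  (ofSpecialFibre X d S h36 Sigma SigmaHat hsub hne hprime hp ⊤ ⊤ (wholeGraph_hle X d S h36)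
      cuspMeetsH).graph.temperedNormallyTerminal_of_prop22
    (graph_prop22_wholeGraph_byName_ofSpecialFibre_of_finiteGraph X d S h36 Sigma SigmaHat hsub hne hprime
      hp cuspMeetsH G hNN σ Λv hvert hΛv src tgt c₁ c₂ hends h₁ h₂ hloop)

end ByName

end StableCurveTemperedData

end Literature.IUT.HodgeTheaters

end
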